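import Mathlib
import Literature.Computability.AlgebraicComplexity.EquivariantDC
import Literature.Computability.AlgebraicComplexity.StandardFamilies
import Summits.ValiantsHypothesis.ValiantsHypothesis.Theorems.SymPencilEquivariantSdcNotQPConjugationNormalForm
import HarnessLib

/-!
# ValiantsHypothesis / SymPencil — crux `SymmetrizePermPairs` (stmt-ValiantsHypothesis-17793),
# line `Cruxes/SdcThesis/Lines/birth_SymmetrizePermPairs.lean`, stub `stub_induce`, piece (I2):
# conjugation normal form for a SUBGROUP `Γ' ≤ Γ_n`

The registered stub `stub_induce` of the `SymmetrizePermPairs` line starts from a `Γ'`-equivariant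
affine determinantal representation of `per_n`, where `Γ'` is a SUBGROUP of
`Γ_n = ⟨permutation matrices of π × ρ⟩ ≤ GL(n², ℂ)` (the route decl only gets equivariance under a
large-index subgroup).  Piece (I2) of the tenure's sizing note («regular-permify for a subgroup»)
re-runs the landed `stub_permify` chain of the sister crux `EquivariantSdcNotQP`
(stmt-ValiantsHypothesis-17792, closed) for such a `Γ'`; the chain's step (i),
`conjugationNormalForm`, is hard-wired to the full `Γ_n` but uses its hypothesis only pointwise.
This file is the subgroup form of step (i) (`--supports stmt-ValiantsHypothesis-17793 --as helper`):

* `conjugationNormalForm_sub` — for `Γ' ≤ Γ_n` and a `Γ'`-equivariant affine determinantal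
  representation `A` of `per_n` (size `m`): `B := A · (c · A(J)⁻¹)` has `det B = per_n`,
  `B(J) = c · 1` (`c ≠ 0`) and CONJUGATION lifts `B(γ · x) = g B(x) g⁻¹` for every `γ ∈ Γ'`
  (same proof as the original: `Γ' ≤ Γ_n` fixes `J`, `eval_one_lift`);
* `conjugationNormalForm_rename_sub` — the same in generator (`rename`) form for a subgroup
  `H ≤ 𝔖_n × 𝔖_n` of permutation PAIRS: `B(x_{π i, ρ j}) = g⁻¹ B(x) g` for every `(π, ρ) ∈ H`
  (`P_{π⁻¹ × ρ⁻¹}` acts by `rename (π × ρ)`, `linSubst_permMatrix`; `(π, ρ)⁻¹ ∈ H`).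

Honest framing: helper layer for an OPEN stub (`stub_induce`) of an OPEN crux (`SymmetrizePermPairs`);
nothing here is the registered stub; `VP ≠ VNP` is NOT proved and nothing here is progress on it.
No new definitions, no named facts.
-/

noncomputable section

-- `Summit.ValiantsHypothesis.ValiantsHypothesis.…` is the tree's mandated single-conjunct layout
-- (Sub = Summit), so the duplicated namespace component is intended.
set_option linter.dupNamespace false

namespace Summit.ValiantsHypothesis.ValiantsHypothesis.Theorems.SymPencilEquivariantSdcNotQP

open Literature.Computability.AlgebraicComplexity MvPolynomial Matrix

/-! ### Step (i) for a subgroup `Γ' ≤ Γ_n` -/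

/-- **Conjugation normal form for a subgroup of `Γ_n`.**  For `Γ' ≤ Γ_n` (the closure of the
permutation matrices of `Equiv.prodCongr π ρ`, spelled VERBATIM as in the route file) and a
`Γ'`-equivariant affine determinantal representation `A` of `per_n` (exact `GL_m × GL_m` lifts, tree
`IsEquivariantDetRepr`), there is, at the SAME size, `B` with `det B = per_n`, `B(J) = c · 1`
(`c ≠ 0`, `J` the all-ones point) and CONJUGATION lifts `B(γ · x) = g B(x) g⁻¹` for every `γ ∈ Γ'`.
Construction as in `conjugationNormalForm`: `B = A · K`, `K = c · A(J)⁻¹`, `c^m = n!`; the only use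
of `Γ' ≤ Γ_n` is that `Γ_n` fixes evaluation at `J` (`eval_one_lift`). [folklore] -/
theorem conjugationNormalForm_sub (n m : ℕ) (Γ' : Subgroup (GL (Fin n × Fin n) ℂ))
    (hle : Γ' ≤ Subgroup.closure {γ : GL (Fin n × Fin n) ℂ | ∃ π ρ : Equiv.Perm (Fin n),
      (γ : Matrix (Fin n × Fin n) (Fin n × Fin n) ℂ) = Equiv.Perm.permMatrix ℂ (Equiv.prodCongr π ρ)})
    (A : Matrix (Fin m) (Fin m) (MvPolynomial (Fin n × Fin n) ℂ))
    (hA : IsEquivariantDetRepr Γ' (perPoly (Fin n) ℂ) A) :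
    ∃ B : Matrix (Fin m) (Fin m) (MvPolynomial (Fin n × Fin n) ℂ),
      IsAffineDetRepr (perPoly (Fin n) ℂ) B ∧
      (∃ c : ℂ, c ≠ 0 ∧ B.map (MvPolynomial.eval fun _ => (1 : ℂ)) = c • (1 : Matrix (Fin m) (Fin m) ℂ)) ∧
      ∀ γ ∈ Γ', ∃ g : GL (Fin m) ℂ, Matrix.linSubstEntries γ B =
          (g : Matrix (Fin m) (Fin m) ℂ).map MvPolynomial.C * B *
            ((g⁻¹ : GL (Fin m) ℂ) : Matrix (Fin m) (Fin m) ℂ).map MvPolynomial.C := by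
  obtain ⟨⟨hdeg, hdet⟩, hlifts⟩ := hA
  set ev : MvPolynomial (Fin n × Fin n) ℂ →+* ℂ := MvPolynomial.eval fun _ => (1 : ℂ) with hev
  set AJ : Matrix (Fin m) (Fin m) ℂ := A.map ev with hAJ
  -- `det A(J) = n! ≠ 0`
  have hdetAJ : AJ.det = (Nat.factorial n : ℂ) := by
    have h := RingHom.map_det ev A
    rw [hdet] at h
    rw [hAJ, ← RingHom.mapMatrix_apply, ← h, hev, eval_perPoly]
    -- `per_n(J) = n!` (also in the tree as `…Theorems.PrincipalMinorColouring.eval_one_perPoly`,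
    -- not imported here to stay out of that route's cone)
    simp [Matrix.permanent, Fintype.card_perm]
  have hfact : (Nat.factorial n : ℂ) ≠ 0 := by exact_mod_cast Nat.factorial_ne_zero n
  have hAJunit : IsUnit AJ.det := by rw [hdetAJ]; exact isUnit_iff_ne_zero.2 hfact
  -- the scalar `c` with `c^m = n!` (for `m = 0` take `c = 1`)
  obtain ⟨c, hc, hcm⟩ : ∃ c : ℂ, c ≠ 0 ∧ (c ^ m * (AJ.det)⁻¹ = 1) := by
    rcases Nat.eq_zero_or_pos m with hm | hm
    · subst hm
      refine ⟨1, one_ne_zero, ?_⟩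
      rw [pow_zero, one_mul, Matrix.det_isEmpty, inv_one]
    · obtain ⟨z, hz⟩ := IsAlgClosed.exists_pow_nat_eq (Nat.factorial n : ℂ) hm
      refine ⟨z, ?_, ?_⟩
      · intro h0
        rw [h0, zero_pow hm.ne'] at hz
        exact hfact hz.symm
      · rw [hz, hdetAJ, mul_inv_cancel₀ hfact]
  -- the constant matrix `K = c · A(J)⁻¹` and `B = A · K`
  set K : Matrix (Fin m) (Fin m) ℂ := c • AJ⁻¹ with hK
  have hdetK : K.det = 1 := by
    rw [hK, Matrix.det_smul, Fintype.card_fin, Matrix.det_nonsing_inv, Ring.inverse_eq_inv']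
    exact hcm
  refine ⟨A * K.map MvPolynomial.C, ⟨?_, ?_⟩, ⟨c, hc, ?_⟩, ?_⟩
  · -- affine entries
    intro a b
    rw [Matrix.mul_apply]
    refine (MvPolynomial.totalDegree_finsetSum _ _).trans (Finset.sup_le fun x _ => ?_)
    refine (MvPolynomial.totalDegree_mul _ _).trans ?_
    rw [Matrix.map_apply, MvPolynomial.totalDegree_C, add_zero]
    exact hdeg a x
  · -- determinant
    rw [Matrix.det_mul, hdet, ← RingHom.mapMatrix_apply, ← RingHom.map_det, hdetK, map_one, mul_one]
  · -- value at `J`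
    have hKev : (K.map MvPolynomial.C).map ev = K := by
      ext a b
      simp [Matrix.map_apply, hev]
    rw [Matrix.map_mul, hKev, ← hAJ, hK, Matrix.mul_smul, Matrix.mul_nonsing_inv _ hAJunit]
  · -- conjugation lifts
    intro γ hγ
    obtain ⟨g, h, hlift⟩ := hlifts γ hγ
    refine ⟨g, ?_⟩
    -- at `J`: `A(J) = g A(J) h⁻¹`, hence `h⁻¹ K = K g⁻¹`
    have hJ := eval_one_lift (hle hγ) hlift
    rw [← hev, ← hAJ] at hJ
    have hcomm : ((h⁻¹ : GL (Fin m) ℂ) : Matrix (Fin m) (Fin m) ℂ) * K =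
        K * ((g⁻¹ : GL (Fin m) ℂ) : Matrix (Fin m) (Fin m) ℂ) := by
      -- `h⁻¹ A(J)⁻¹` is a left inverse of `g A(J)`
      have hgA : (g : Matrix (Fin m) (Fin m) ℂ) * AJ = AJ * (h : Matrix (Fin m) (Fin m) ℂ) := by
        calc (g : Matrix (Fin m) (Fin m) ℂ) * AJ
            = (g : Matrix (Fin m) (Fin m) ℂ) * AJ *
                (((h⁻¹ : GL (Fin m) ℂ) : Matrix (Fin m) (Fin m) ℂ) * (h : Matrix (Fin m) (Fin m) ℂ)) := by
              rw [← Units.val_mul, inv_mul_cancel, Units.val_one, Matrix.mul_one]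
          _ = ((g : Matrix (Fin m) (Fin m) ℂ) * AJ * ((h⁻¹ : GL (Fin m) ℂ) : Matrix (Fin m) (Fin m) ℂ)) *
                (h : Matrix (Fin m) (Fin m) ℂ) := by
              simp only [Matrix.mul_assoc]
          _ = AJ * (h : Matrix (Fin m) (Fin m) ℂ) := by rw [← hJ]
      have hleft : (((h⁻¹ : GL (Fin m) ℂ) : Matrix (Fin m) (Fin m) ℂ) * AJ⁻¹) *
          ((g : Matrix (Fin m) (Fin m) ℂ) * AJ) = 1 := by
        rw [hgA, Matrix.mul_assoc, ← Matrix.mul_assoc AJ⁻¹, Matrix.nonsing_inv_mul _ hAJunit,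
          Matrix.one_mul, ← Units.val_mul, inv_mul_cancel, Units.val_one]
      have hinv : ((g : Matrix (Fin m) (Fin m) ℂ) * AJ)⁻¹ =
          ((h⁻¹ : GL (Fin m) ℂ) : Matrix (Fin m) (Fin m) ℂ) * AJ⁻¹ := Matrix.inv_eq_left_inv hleft
      rw [Matrix.mul_inv_rev, ← Matrix.coe_units_inv] at hinv
      rw [hK, Matrix.mul_smul, Matrix.smul_mul, ← hinv]
    calc Matrix.linSubstEntries γ (A * K.map MvPolynomial.C)
        = Matrix.linSubstEntries γ A * K.map MvPolynomial.C := by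
          simp only [Matrix.linSubstEntries]
          rw [Matrix.map_mul]
          congr 1
          ext a b
          simp [Matrix.map_apply]
      _ = (g : Matrix (Fin m) (Fin m) ℂ).map MvPolynomial.C * A *
            ((((h⁻¹ : GL (Fin m) ℂ) : Matrix (Fin m) (Fin m) ℂ) * K).map MvPolynomial.C) := by
          rw [hlift, Matrix.map_mul, Matrix.mul_assoc]
      _ = (g : Matrix (Fin m) (Fin m) ℂ).map MvPolynomial.C * A *
            ((K * ((g⁻¹ : GL (Fin m) ℂ) : Matrix (Fin m) (Fin m) ℂ)).map MvPolynomial.C) := by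
          rw [hcomm]
      _ = (g : Matrix (Fin m) (Fin m) ℂ).map MvPolynomial.C * (A * K.map MvPolynomial.C) *
            ((g⁻¹ : GL (Fin m) ℂ) : Matrix (Fin m) (Fin m) ℂ).map MvPolynomial.C := by
          rw [Matrix.map_mul, ← Matrix.mul_assoc, Matrix.mul_assoc _ A]

/-! ### Step (i) in `rename` form, for a subgroup of permutation pairs -/

/-- **Conjugation normal form, generator form, for a subgroup `H ≤ 𝔖_n × 𝔖_n`.**  If `A` is an
affine determinantal representation of `per_n` equivariant (exact `GL_m × GL_m` lifts) under the
subgroup of `GL(n², ℂ)` generated by the permutation matrices of the pairs in `H`, then at the same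
size there is `B` with `det B = per_n`, `B(J) = c · 1` (`c ≠ 0`) and, for every `(π, ρ) ∈ H`, a
conjugation `B(x_{π i, ρ j}) = g⁻¹ B(x) g`, `g ∈ GL_m(ℂ)`: the generator `P_{π⁻¹ × ρ⁻¹}` (in the group,
as `(π, ρ)⁻¹ ∈ H`) acts on polynomials by `rename (π × ρ)` (`linSubst_permMatrix`).  Subgroup form
of `conjugationNormalForm_rename`. [folklore] -/
theorem conjugationNormalForm_rename_sub (n m : ℕ)
    (H : Subgroup (Equiv.Perm (Fin n) × Equiv.Perm (Fin n)))
    (A : Matrix (Fin m) (Fin m) (MvPolynomial (Fin n × Fin n) ℂ))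
    (hA : IsEquivariantDetRepr (Subgroup.closure {γ : GL (Fin n × Fin n) ℂ |
        ∃ πρ ∈ H, (γ : Matrix (Fin n × Fin n) (Fin n × Fin n) ℂ) =
          Equiv.Perm.permMatrix ℂ (Equiv.prodCongr πρ.1 πρ.2)}) (perPoly (Fin n) ℂ) A) :
    ∃ B : Matrix (Fin m) (Fin m) (MvPolynomial (Fin n × Fin n) ℂ),
      IsAffineDetRepr (perPoly (Fin n) ℂ) B ∧
      (∃ c : ℂ, c ≠ 0 ∧
        B.map (MvPolynomial.eval fun _ => (1 : ℂ)) = c • (1 : Matrix (Fin m) (Fin m) ℂ)) ∧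
      ∀ πρ ∈ H, ∃ g : GL (Fin m) ℂ,
        B.map (MvPolynomial.rename fun ij : Fin n × Fin n => (πρ.1 ij.1, πρ.2 ij.2)) =
          ((g⁻¹ : GL (Fin m) ℂ) : Matrix (Fin m) (Fin m) ℂ).map MvPolynomial.C * B *
            (g : Matrix (Fin m) (Fin m) ℂ).map MvPolynomial.C := by
  have hle : Subgroup.closure {γ : GL (Fin n × Fin n) ℂ |
        ∃ πρ ∈ H, (γ : Matrix (Fin n × Fin n) (Fin n × Fin n) ℂ) =
          Equiv.Perm.permMatrix ℂ (Equiv.prodCongr πρ.1 πρ.2)} ≤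
      Subgroup.closure {γ : GL (Fin n × Fin n) ℂ | ∃ π ρ : Equiv.Perm (Fin n),
        (γ : Matrix (Fin n × Fin n) (Fin n × Fin n) ℂ) =
          Equiv.Perm.permMatrix ℂ (Equiv.prodCongr π ρ)} := by
    refine Subgroup.closure_mono ?_
    rintro γ ⟨πρ, -, hγ⟩
    exact ⟨πρ.1, πρ.2, hγ⟩
  obtain ⟨B, hB, hBJ, hlifts⟩ := conjugationNormalForm_sub n m _ hle A hA
  refine ⟨B, hB, hBJ, fun πρ hπρ => ?_⟩
  obtain ⟨π, ρ⟩ := πρ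
  set e : Equiv.Perm (Fin n × Fin n) := Equiv.prodCongr π⁻¹ ρ⁻¹ with he
  -- the generator `P_e` as an element of `GL(n², ℂ)`
  let γ : GL (Fin n × Fin n) ℂ :=
    ⟨e.permMatrix ℂ, e⁻¹.permMatrix ℂ,
      by rw [← Matrix.permMatrix_mul, inv_mul_cancel, Matrix.permMatrix_one],
      by rw [← Matrix.permMatrix_mul, mul_inv_cancel, Matrix.permMatrix_one]⟩
  have hγ : γ ∈ Subgroup.closure {γ : GL (Fin n × Fin n) ℂ |
      ∃ πρ ∈ H, (γ : Matrix (Fin n × Fin n) (Fin n × Fin n) ℂ) =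
        Equiv.Perm.permMatrix ℂ (Equiv.prodCongr πρ.1 πρ.2)} :=
    Subgroup.subset_closure ⟨(π, ρ)⁻¹, H.inv_mem hπρ, rfl⟩
  obtain ⟨g, hg⟩ := hlifts γ hγ
  refine ⟨g⁻¹, ?_⟩
  rw [inv_inv]
  have hsub : Matrix.linSubstEntries γ B =
      B.map (MvPolynomial.rename fun ij : Fin n × Fin n => (π ij.1, ρ ij.2)) := by
    change B.map (linSubst (Fin n × Fin n) ℂ (e.permMatrix ℂ)) = _
    rw [linSubst_permMatrix]
    have hfun : (⇑e.symm : Fin n × Fin n → Fin n × Fin n) = fun ij => (π ij.1, ρ ij.2) := by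
      funext ij
      simp only [he, Equiv.prodCongr_symm, Equiv.prodCongr_apply, Equiv.Perm.inv_def,
        Equiv.symm_symm]
      rfl
    rw [hfun]
  rw [← hsub, hg]

end Summit.ValiantsHypothesis.ValiantsHypothesis.Theorems.SymPencilEquivariantSdcNotQP

end
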